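import Summits.Ventures.PercRepro.SixFourIdentities
import Summits.Ventures.PercRepro.OrbitK

/-!
# PercRepro — C-025 at `(q + 2, q)`: the per-flat balance of the hard max-trace rule for EVERY `q` — the objects
(night-4, gen 0; part A of two, part B = `GenQDichotomy.lean`)

The `(6, 4)` chain of the cell (`SixFourIdentities` … `SixFourResidueThreePieces`) proves the rank level-set
inequality through the PER-SOLID BALANCE `J_t(G) = Σ_{B ∈ R₄(G)} (6 − t)·w_∞(B) − (6/5)·(N₄ − DF_t)` on the
rank-`4` sets `G` of a simple matroid (`w_∞(B) = 1/(1 + m(B))`, `m(B)` = the coloops of `M|B`).  Nothing in that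
balance is special to `q = 4` except the numbers: at `(p, q) = (q + 2, q)` the hard max-trace rule is single-level,
`Φ(q + 2, q) = (q + 2)/(q + 1)`, a rank-`q` set `B ⊆ G` receives `(q + 2 − t)/(1 + m(B))` from its single-point
witnesses, and the demand is `Φ` on every `B` with `ρ(G ∖ B) ≥ t` (mine-2's `MINE2-RLS.md` §23.1 (S)).  This file
defines the general balance and proves its first structural facts, valid for every `q` with no table:

* `Rq`, `Nq`, `DFq`, **`Jq M G q t`** — the balance at `(q + 2, q)` and type `t`; `Jq_four`: at `q = 4` it IS the
  landed `J` of the `(6, 4)` chain; `phiK_succ_succ`: `Φ(q + 2, q) = (q + 2)/(q + 1)` — the constant of the balance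
  is the constant of the row;
* `indep_coloopsOf` / `mTr_le_of_eRk_eq`: the coloops of `M|B` are independent, so `m(B) ≤ q` and
  `w_∞(B) ≥ 1/(q + 1)` (`wInf_ge_of_eRk_eq`);
* `Jq_zero_nonneg`: the type-`0` balance holds for every `G`;
* `exists_coloop_of_mTr_pos`: a THIN set (`m(B) ≥ 1`) is `Z ∪ {a}` with `ρ(Z) + 1 ≤ q` — it lies in a hyperplane
  trace of `G` plus one point;
* `TwoHyp M G q` — mine-2's family `𝔉` (Lemma 21.4) at every `q`: `G ⊆ Z ∪ Z′ ∪ {a, a′}` with `ρ(Z), ρ(Z′) ≤ q − 1`,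
  and the two ways a thin set puts `G` into `𝔉` (`twoHyp_of_thin_of_sdiff_lt`, `twoHyp_of_thin_of_thin`).

Part B (`GenQDichotomy.lean`) proves the dichotomy `G ∉ 𝔉 ⇒ 0 ≤ Jq M G q t` for every `q` and every `t ≤ q`, the
«hyperplane + one point» case, and states the residue `PerFlatResidue q`.  Imports `SixFourIdentities` (the coloop
objects) and `OrbitK` (`phiK`) only.
-/
namespace PercRepro.GenQ

open Finset ThmH SixFour

variable {α : Type*} [DecidableEq α] {M : Matroid α} [M.Finite]

/-! ## The general balance -/

/-- The rank-`q` subsets of `G` (`R_q(G)`). -/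
noncomputable def Rq (M : Matroid α) [M.Finite] (G : Finset α) (q : ℕ) : Finset (Finset α) :=
  G.powerset.filter (fun B : Finset α => M.eRk ((B : Finset α) : Set α) = (q : ℕ∞))

omit [DecidableEq α] in
/-- Membership in `Rq`. -/
theorem mem_Rq {G B : Finset α} {q : ℕ} : B ∈ Rq M G q ↔ B ⊆ G ∧ M.eRk (B : Set α) = (q : ℕ∞) := by
  unfold Rq
  simp only [Finset.mem_filter, Finset.mem_powerset]

omit [DecidableEq α] in
/-- At `q = 4`, `Rq` is the landed `R4`. -/
theorem Rq_four (G : Finset α) : Rq M G 4 = R4 M G := by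
  unfold Rq R4
  simp only [Nat.cast_ofNat]

/-- `N_q(G) = |R_q(G)|`. -/
noncomputable def Nq (M : Matroid α) [M.Finite] (G : Finset α) (q : ℕ) : ℕ := (Rq M G q).card

/-- `DF_t(G)`: the demand-free rank-`q` subsets, `ρ(G ∖ B) + 1 ≤ t`. -/
noncomputable def DFq (M : Matroid α) [M.Finite] (G : Finset α) (q t : ℕ) : ℕ :=
  ((Rq M G q).filter (fun B : Finset α => M.eRk ((G \ B : Finset α) : Set α) + 1 ≤ (t : ℕ∞))).card

/-- The per-flat balance at `(q + 2, q)` and type `t`: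
`Jq(G) = Σ_{B ∈ R_q(G)} (q + 2 − t)·w_∞(B) − ((q + 2)/(q + 1))·(N_q − DF_t)`. -/
noncomputable def Jq (M : Matroid α) [M.Finite] (G : Finset α) (q t : ℕ) : ℚ :=
  (∑ B ∈ Rq M G q, ((q : ℚ) + 2 - t) * wInf M B) -
    (((q : ℚ) + 2) / ((q : ℚ) + 1)) * ((Nq M G q : ℚ) - (DFq M G q t : ℚ))

/-- At `q = 4` the general balance is the landed `J` of the `(6, 4)` chain. -/
theorem Jq_four (G : Finset α) (t : ℕ) : Jq M G 4 t = J M G t := by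
  unfold Jq J Nq DFq N4 DF
  rw [Rq_four]
  norm_num

/-- `Φ(q + 2, q) = (q + 2)/(q + 1)`: the constant of the balance is `phiK (q + 2) q`. -/
theorem phiK_succ_succ (q : ℕ) : phiK (q + 2) q = ((q : ℚ) + 2) / ((q : ℚ) + 1) := by
  unfold phiK
  have hIoo : Finset.Ioo q (q + 2) = {q + 1} := by
    ext u
    simp only [Finset.mem_Ioo, Finset.mem_singleton]
    omega
  rw [hIoo, Finset.sum_singleton]
  have h1 := Nat.choose_succ_right_eq (q + 2 + q) (q + 1)
  have hpos : (0 : ℚ) < ((q + 2 + q).choose (q + 2) : ℚ) := by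
    exact_mod_cast Nat.choose_pos (by omega)
  have hpos' : (0 : ℚ) < (q : ℚ) + 1 := by positivity
  rw [div_eq_div_iff hpos.ne' hpos'.ne']
  have h2 : ((q + 2 + q).choose (q + 1 + 1) : ℚ) * ((q : ℚ) + 1 + 1) =
      ((q + 2 + q).choose (q + 1) : ℚ) * ((q + 2 + q - (q + 1) : ℕ) : ℚ) := by
    exact_mod_cast h1
  have h3 : ((q + 2 + q - (q + 1) : ℕ) : ℚ) = (q : ℚ) + 1 := by
    rw [show q + 2 + q - (q + 1) = q + 1 by omega]
    push_cast
    ring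
  rw [h3] at h2
  rw [show q + 1 + 1 = q + 2 by omega] at h2
  linarith

/-! ## The coloops of `M|B` are independent: `m(B) ≤ ρ(B)` -/

/-- `coloopsOf M B ⊆ B`. -/
theorem coloopsOf_subset (B : Finset α) : coloopsOf M B ⊆ B := by
  intro x hx
  exact (mem_coloopsOf.1 hx).1

/-- The coloops of `M|B` form an independent set. -/
theorem indep_coloopsOf {B : Finset α} (hB : B ⊆ gr M) : M.Indep ((coloopsOf M B : Finset α) : Set α) := by
  rw [Matroid.indep_iff_forall_notMem_closure_sdiff']
  refine ⟨?_, ?_⟩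
  · intro x hx
    have hxB : x ∈ B := coloopsOf_subset B (Finset.mem_coe.1 hx)
    rw [← coe_gr M]
    exact_mod_cast hB hxB
  · intro e he hcl
    have he' := mem_coloopsOf.1 he
    apply he'.2
    refine M.closure_subset_closure ?_ hcl
    intro y hy
    simp only [Set.mem_sdiff, Finset.mem_coe, Set.mem_singleton_iff] at hy
    rw [Finset.mem_coe, Finset.mem_erase]
    exact ⟨hy.2, coloopsOf_subset B hy.1⟩

/-- `m(B) ≤ ρ(B)` (as extended naturals). -/
theorem mTr_le_eRk {B : Finset α} (hB : B ⊆ gr M) : (mTr M B : ℕ∞) ≤ M.eRk (B : Set α) := by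
  have h := (indep_coloopsOf hB).encard_le_eRk_of_subset (Finset.coe_subset.2 (coloopsOf_subset B))
  rw [Set.encard_coe_eq_coe_finsetCard] at h
  exact h

/-- A rank-`q` set has at most `q` coloops. -/
theorem mTr_le_of_eRk_eq {B : Finset α} {q : ℕ} (hB : B ⊆ gr M) (hr : M.eRk (B : Set α) = (q : ℕ∞)) :
    mTr M B ≤ q := by
  have h := mTr_le_eRk hB
  rw [hr] at h
  exact_mod_cast h

/-- `w_∞(B) ≥ 1/(q + 1)` for a rank-`q` set. -/
theorem wInf_ge_of_eRk_eq {B : Finset α} {q : ℕ} (hB : B ⊆ gr M) (hr : M.eRk (B : Set α) = (q : ℕ∞)) :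
    1 / ((q : ℚ) + 1) ≤ wInf M B := by
  unfold wInf
  have h : (mTr M B : ℚ) ≤ q := by exact_mod_cast mTr_le_of_eRk_eq hB hr
  apply one_div_le_one_div_of_le
  · positivity
  · linarith

/-! ## The type-`0` balance, for every `G` -/

/-- `N_q − DF_t` is the number of demanding sets. -/
theorem Nq_sub_DFq (G : Finset α) (q t : ℕ) :
    (Nq M G q : ℚ) - (DFq M G q t : ℚ) =
      (((Rq M G q).filter (fun B : Finset α => ¬ (M.eRk ((G \ B : Finset α) : Set α) + 1 ≤ (t : ℕ∞)))).card : ℚ) := by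
  unfold Nq DFq
  have h := Finset.card_filter_add_card_filter_not
    (s := Rq M G q) (p := fun B : Finset α => M.eRk ((G \ B : Finset α) : Set α) + 1 ≤ (t : ℕ∞))
  have h' : ((Rq M G q).card : ℚ) =
      (((Rq M G q).filter (fun B : Finset α => M.eRk ((G \ B : Finset α) : Set α) + 1 ≤ (t : ℕ∞))).card : ℚ) +
      (((Rq M G q).filter (fun B : Finset α => ¬ (M.eRk ((G \ B : Finset α) : Set α) + 1 ≤ (t : ℕ∞)))).card : ℚ) := by
    exact_mod_cast h.symm
  linarith

/-- **The type-`0` balance** holds for every subset `G` of the ground set and every `q`. -/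
theorem Jq_zero_nonneg {G : Finset α} (hG : G ⊆ gr M) (q : ℕ) : 0 ≤ Jq M G q 0 := by
  unfold Jq
  have hq1 : (0 : ℚ) < (q : ℚ) + 1 := by positivity
  have hsum : ((Nq M G q : ℚ)) * (((q : ℚ) + 2) / ((q : ℚ) + 1)) ≤
      ∑ B ∈ Rq M G q, ((q : ℚ) + 2 - (0 : ℕ)) * wInf M B := by
    unfold Nq
    rw [← nsmul_eq_mul]
    apply Finset.card_nsmul_le_sum
    intro B hB
    have hB' := mem_Rq.1 hB
    have hw := wInf_ge_of_eRk_eq (hB'.1.trans hG) hB'.2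
    have hq2 : (0 : ℚ) ≤ (q : ℚ) + 2 := by positivity
    calc ((q : ℚ) + 2) / ((q : ℚ) + 1) = ((q : ℚ) + 2) * (1 / ((q : ℚ) + 1)) := by ring
      _ ≤ ((q : ℚ) + 2) * wInf M B := by gcongr
      _ = ((q : ℚ) + 2 - (0 : ℕ)) * wInf M B := by simp
  have hDF : (0 : ℚ) ≤ (DFq M G q 0 : ℚ) := by positivity
  have hΦ : (0 : ℚ) ≤ ((q : ℚ) + 2) / ((q : ℚ) + 1) := by positivity
  nlinarith [mul_nonneg hΦ hDF]

/-! ## Thin sets and the family `𝔉` -/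

/-- A set with a coloop splits off that coloop: `B = (B ∖ a) ∪ {a}` with `ρ(B ∖ a) + 1 = ρ(B)`. -/
theorem exists_coloop_of_mTr_pos {B : Finset α} (hB : B ⊆ gr M) (hm : mTr M B ≠ 0) :
    ∃ a ∈ B, M.eRk ((B.erase a : Finset α) : Set α) + 1 = M.eRk (B : Set α) := by
  unfold mTr at hm
  obtain ⟨a, ha⟩ := Finset.card_pos.1 (Nat.pos_of_ne_zero hm)
  have ha' := mem_coloopsOf.1 ha
  refine ⟨a, ha'.1, ?_⟩
  have haE : a ∈ M.E := by
    rw [← coe_gr M]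
    exact_mod_cast hB ha'.1
  have h := Matroid.eRk_insert_eq_add_one (M := M) (e := a) (X := ((B.erase a : Finset α) : Set α))
    ⟨haE, ha'.2⟩
  rw [← Finset.coe_insert, Finset.insert_erase ha'.1] at h
  exact h.symm

/-- mine-2's family `𝔉` at every `q` (Lemma 21.4): `G` is covered by two sets of rank `≤ q − 1` and two points —
two hyperplane traces of `G` plus a point each. -/
def TwoHyp (M : Matroid α) [M.Finite] (G : Finset α) (q : ℕ) : Prop :=
  ∃ Z Z' : Finset α, ∃ a a' : α, Z ⊆ G ∧ Z' ⊆ G ∧ M.eRk (Z : Set α) + 1 ≤ (q : ℕ∞) ∧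
    M.eRk (Z' : Set α) + 1 ≤ (q : ℕ∞) ∧ G ⊆ Z ∪ Z' ∪ {a, a'}

/-- A thin rank-`q` set `B ⊆ G` with a complement of rank `< q` puts `G` in `𝔉`. -/
theorem twoHyp_of_thin_of_sdiff_lt {G B : Finset α} {q : ℕ} (hG : G ⊆ gr M) (hB : B ⊆ G)
    (hr : M.eRk (B : Set α) = (q : ℕ∞)) (hm : mTr M B ≠ 0)
    (hc : M.eRk ((G \ B : Finset α) : Set α) + 1 ≤ (q : ℕ∞)) : TwoHyp M G q := by
  obtain ⟨a, haB, ha⟩ := exists_coloop_of_mTr_pos (hB.trans hG) hm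
  refine ⟨B.erase a, G \ B, a, a, (Finset.erase_subset a B).trans hB, Finset.sdiff_subset, ?_, hc, ?_⟩
  · rw [ha, hr]
  · intro g hg
    by_cases hgB : g ∈ B
    · by_cases hga : g = a
      · subst hga
        simp
      · simp [Finset.mem_erase, hga, hgB]
    · simp [hgB, hg]

/-- Two complementary thin rank-`q` sets put `G` in `𝔉`. -/
theorem twoHyp_of_thin_of_thin {G B : Finset α} {q : ℕ} (hG : G ⊆ gr M) (hB : B ⊆ G)
    (hr : M.eRk (B : Set α) = (q : ℕ∞)) (hm : mTr M B ≠ 0)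
    (hr' : M.eRk ((G \ B : Finset α) : Set α) = (q : ℕ∞)) (hm' : mTr M (G \ B) ≠ 0) : TwoHyp M G q := by
  obtain ⟨a, haB, ha⟩ := exists_coloop_of_mTr_pos (hB.trans hG) hm
  obtain ⟨a', ha'B, ha'⟩ := exists_coloop_of_mTr_pos (Finset.sdiff_subset.trans hG) hm'
  refine ⟨B.erase a, (G \ B).erase a', a, a', (Finset.erase_subset a B).trans hB,
    (Finset.erase_subset a' (G \ B)).trans Finset.sdiff_subset, ?_, ?_, ?_⟩
  · rw [ha, hr]
  · rw [ha', hr']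
  · intro g hg
    by_cases hgB : g ∈ B
    · by_cases hga : g = a
      · subst hga
        simp
      · simp [Finset.mem_erase, hga, hgB]
    · by_cases hga' : g = a'
      · subst hga'
        simp
      · simp [Finset.mem_erase, hga', hgB, hg]

end PercRepro.GenQ
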